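import Summits.FinalStateConjecture.FinalStateConjecture.Theorems.SwallowTheDatumUniversalWitnessFamilyRegionOneCausal
import Summits.FinalStateConjecture.FinalStateConjecture.Theorems.SwallowTheDatumUniversalWitnessFamilyRegionOneHoleChart
import Literature.Geometry.Lorentzian.ModelData

/-!
# Crux `SwallowTheDatum.UniversalWitnessFamily` (stmt-FinalStateConjecture-10051), line `Sketch`,
# stub `stub_regionOneDecomposition` — part 3: static time is a time function; the static slice

* STATIC TIME IS A TIME FUNCTION: `d(staticTime)(v) > 0` for every future-directed causal `v`
  (`fderiv_staticTime_pos`: with `h = 2M/r`, `w = ⟪x̃, ṽ⟫/r`, causality gives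
  `((1 − h)v⁰ − (1 + h)w)(v⁰ + w) ≥ 0`, and `v⁰ > 0`), hence static time is non-decreasing along
  future causal curves (`staticTime_le_of_isFutureCausalCurveOn`) and on causal futures
  (`staticTime_le_of_mem_causalFuture`);
* `range_sheet_eq` — the static slice map `ψ(y) = (2M log(r/2M − 1), (1 + M/2ρ)² y)` of the open
  sheet `{‖y‖ > M/2}` has range EXACTLY the static slice `Σ₀ = {t = 0}` of the Kerr–Schild exterior
  (`staticTime = 0`); the inverse areal-to-isotropic radius is `ρ = (r − M + √(r² − 2Mr))/2`;
* `causalFuture_range_sheet` — `J⁺(Σ₀) = {t ≥ 0}`: static time is a time function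
  (`exists_staticTime_le_of_mem_causalFuture`), and every event with `t ≥ 0` sits vertically above
  the slice point `x − t(x) e₀`.

References: MTW 1973, §31.7, (31.22); O'Neill 1983, Ch. 13; Wald 1984, §6.4.
-/

set_option linter.dupNamespace false

noncomputable section

open scoped Manifold ContDiff Topology RealInnerProductSpace
open Set Function Filter Literature.Geometry.Lorentzian

namespace Summit.FinalStateConjecture.FinalStateConjecture.Theorems.SwallowTheDatum.UniversalWitnessFamily

/-! ## Static time is a time function -/

section TimeFunction

variable {M : ℝ}

/-- **The differential of static time**: `d(staticTime)(v) = v⁰ − (2M/(r − 2M)) ⟪x̃, ṽ⟫/r`. -/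
theorem hasFDerivAt_staticTime (hM : 0 < M) {x : E4} (hx : 2 * M < E4.spatialNorm x) :
    HasFDerivAt (staticTime M)
      ((EuclideanSpace.proj (0 : Fin 4) : E4 →L[ℝ] ℝ) -
        (2 * M / (E4.spatialNorm x - 2 * M)) •
          ((E4.spatialNorm x)⁻¹ • ((innerSL ℝ (E4.spatial x)).comp E4.spatial))) x := by
  have hx0 : E4.spatialNorm x ≠ 0 := by linarith
  have h1 := hasFDerivAt_spatialNorm hx0
  have h2 := (hasDerivAt_torH hM hx).comp_hasFDerivAt x h1
  have h3 : HasFDerivAt (fun y : E4 ↦ y 0) (EuclideanSpace.proj (0 : Fin 4) : E4 →L[ℝ] ℝ) x :=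
    (EuclideanSpace.proj (0 : Fin 4) (𝕜 := ℝ)).hasFDerivAt
  exact h3.sub h2

/-- The differential of static time, applied to a vector. -/
theorem fderiv_staticTime_apply (hM : 0 < M) {x : E4} (hx : 2 * M < E4.spatialNorm x) (v : E4) :
    fderiv ℝ (staticTime M) x v =
      v 0 - 2 * M / (E4.spatialNorm x - 2 * M) *
        (⟪E4.spatial x, E4.spatial v⟫ / E4.spatialNorm x) := by
  rw [(hasFDerivAt_staticTime hM hx).fderiv]
  simp [div_eq_inv_mul, mul_comm, mul_assoc, mul_left_comm]

/-- **STATIC TIME IS A TIME FUNCTION (pointwise)**: at a point of `{r > 2M}`, every vector `v`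
which is causal for `g_{M,0}` and future-directed (`g(V, v) < 0`, i.e. `v⁰ > 0`) has
`d(staticTime)(v) > 0`.  With `h = 2M/r < 1` and `w = ⟪x̃, ṽ⟫/r`, causality
`−(v⁰)² + ‖ṽ‖² + h(v⁰ + w)² ≤ 0` and `w² ≤ ‖ṽ‖²` give `((1 − h)v⁰ − (1 + h)w)(v⁰ + w) ≥ 0`, whence
`(1 − h)v⁰ − h w > 0`. -/
theorem fderiv_staticTime_pos [Kerr.Facts] (hM : 0 < M) (x : Kerr.region 0 (Kerr.rPlus M 0))
    {v : E4} (hv : (ksTime hM.le).IsFutureDirected (show TangentSpace 𝓘(ℝ, E4) x from v)) :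
    0 < fderiv ℝ (staticTime M) x.1 v := by
  have hx : 2 * M < E4.spatialNorm x.1 := two_mul_lt_spatialNorm hM.le x
  set r := E4.spatialNorm x.1 with hr
  have hr0 : r ≠ 0 := by linarith
  have hrpos : 0 < r := by linarith
  obtain ⟨⟨hcausal, -⟩, hfut⟩ := hv
  -- `v⁰ > 0`
  have hv0 : 0 < v 0 := by
    have h := hfut
    change Kerr.bilin M 0 x.1 (Kerr.timeVector M 0 x.1) v < 0 at h
    rw [Kerr.bilin_timeVector (radius_pos hM.le x)] at h
    linarith
  -- causality unfolded
  have hc : Kerr.bilin M 0 x.1 v v ≤ 0 := hcausal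
  rw [kerr_bilin_zero_spin_self hr0] at hc
  set w := ⟪E4.spatial x.1, E4.spatial v⟫ / r with hw
  set h := 2 * M / r with hh
  have hh0 : 0 < h := by positivity
  have hh1 : h < 1 := by rw [hh, div_lt_one hrpos]; exact hx
  -- Cauchy–Schwarz: `w² ≤ ‖ṽ‖²`
  have hcs : w ^ 2 ≤ ‖E4.spatial v‖ ^ 2 := by
    have h1 := abs_real_inner_le_norm (E4.spatial x.1) (E4.spatial v)
    have h2 : ‖E4.spatial x.1‖ = r := rfl
    rw [h2] at h1
    have h3 : |w| ≤ ‖E4.spatial v‖ := by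
      rw [hw, abs_div, abs_of_pos hrpos, div_le_iff₀ hrpos]
      linarith [mul_comm r ‖E4.spatial v‖]
    nlinarith [abs_nonneg w, sq_abs w, norm_nonneg (E4.spatial v)]
  have hQ : -(v 0) ^ 2 + w ^ 2 + h * (v 0 + w) ^ 2 ≤ 0 := by nlinarith
  -- the key inequality `(1 − h)v⁰ − h w > 0`
  have h1h : 0 < 1 - h := by linarith
  have key : 0 < (1 - h) * v 0 - h * w := by
    by_cases hw0 : w ≤ 0
    · nlinarith
    · push Not at hw0
      -- `((1 − h)v⁰ − (1 + h)w)(v⁰ + w) ≥ 0` with `v⁰ + w > 0`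
      have hprod : 0 ≤ ((1 - h) * v 0 - (1 + h) * w) * (v 0 + w) := by nlinarith
      have hsum : 0 < v 0 + w := by linarith
      have hfac : 0 ≤ (1 - h) * v 0 - (1 + h) * w := nonneg_of_mul_nonneg_left hprod hsum
      nlinarith
  -- the derivative
  rw [fderiv_staticTime_apply hM hx]
  show 0 < v 0 - 2 * M / (r - 2 * M) * w
  have hr2 : r - 2 * M ≠ 0 := by linarith
  have hcoef : v 0 - 2 * M / (r - 2 * M) * w = ((1 - h) * v 0 - h * w) / (1 - h) := by
    rw [hh]
    field_simp
  rw [hcoef]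
  exact div_pos key h1h

/-- **Static time is non-decreasing along future causal curves** of the Schwarzschild exterior
(chain rule + `fderiv_staticTime_pos`, then the mean value inequality on `[a, b]`). -/
theorem staticTime_le_of_isFutureCausalCurveOn [Kerr.Facts] (hM : 0 < M)
    {γ : ℝ → Kerr.region 0 (Kerr.rPlus M 0)} {a b : ℝ} (hab : a ≤ b)
    (hγ : (Kerr.smoothMetric M 0 (Kerr.rPlus M 0)).IsFutureCausalCurveOn (ksTime hM.le) γ (Icc a b)) :
    staticTime M (γ a).1 ≤ staticTime M (γ b).1 := by
  -- the real function `f = staticTime ∘ γ` has nonnegative derivative on `[a, b]`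
  set f : ℝ → ℝ := fun t ↦ staticTime M (γ t).1 with hf
  have hderiv : ∀ t ∈ Icc a b, HasDerivAt f
      (fderiv ℝ (staticTime M) (γ t).1 (velocity 𝓘(ℝ, E4) γ t : E4)) t ∧
      0 ≤ fderiv ℝ (staticTime M) (γ t).1 (velocity 𝓘(ℝ, E4) γ t : E4) := by
    intro t ht
    obtain ⟨hd, hfut⟩ := hγ t ht
    have hx : 2 * M < E4.spatialNorm (γ t).1 := two_mul_lt_spatialNorm hM.le (γ t)
    -- `val ∘ γ` is differentiable with derivative the velocity
    have hmd : MDifferentiableAt 𝓘(ℝ, ℝ) 𝓘(ℝ, E4) (Subtype.val ∘ γ) t :=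
      (mdifferentiableAt_subtypeVal_comp_curve_iff _).2 hd
    have hdiff : DifferentiableAt ℝ (Subtype.val ∘ γ) t := hmd.differentiableAt
    have e1 : (velocity 𝓘(ℝ, E4) (Subtype.val ∘ γ) t : E4) = deriv (Subtype.val ∘ γ) t := by
      change mfderiv 𝓘(ℝ, ℝ) 𝓘(ℝ, E4) (Subtype.val ∘ γ) t (1 : ℝ) = _
      rw [mfderiv_eq_fderiv]
      rfl
    have e2 := velocity_subtypeVal_comp (I := 𝓘(ℝ, E4)) (Kerr.region 0 (Kerr.rPlus M 0)) γ t
    have hder : HasDerivAt (Subtype.val ∘ γ) (velocity 𝓘(ℝ, E4) γ t : E4) t := by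
      rw [← e2, e1]
      exact hdiff.hasDerivAt
    have h1 := (hasFDerivAt_staticTime hM hx).comp_hasDerivAt t hder
    rw [← (hasFDerivAt_staticTime hM hx).fderiv] at h1
    exact ⟨h1, (fderiv_staticTime_pos hM (γ t) hfut).le⟩
  have hcont : ContinuousOn f (Icc a b) := fun t ht ↦ (hderiv t ht).1.continuousAt.continuousWithinAt
  have hmono := monotoneOn_of_hasDerivWithinAt_nonneg (convex_Icc a b) hcont
    (fun t ht ↦ ((hderiv t (interior_subset ht)).1).hasDerivWithinAt)
    (fun t ht ↦ (hderiv t (interior_subset ht)).2)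
  exact hmono (left_mem_Icc.2 hab) (right_mem_Icc.2 hab) hab

/-- **Static time is non-decreasing on causal futures**: `p ∈ J⁺(x) ⟹ t(x) ≤ t(p)`. -/
theorem staticTime_le_of_mem_causalFuture [Kerr.Facts] (hM : 0 < M)
    {x p : Kerr.region 0 (Kerr.rPlus M 0)}
    (hp : p ∈ (Kerr.smoothMetric M 0 (Kerr.rPlus M 0)).causalFuture (ksTime hM.le) {x}) :
    staticTime M x.1 ≤ staticTime M p.1 := by
  rcases hp with hp | ⟨x', hx', γ, a, b, hab, hγ, hγa, hγb⟩
  · rw [mem_singleton_iff] at hp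
    rw [hp]
  · rw [mem_singleton_iff] at hx'
    subst hx'
    rw [← hγa, ← hγb]
    exact staticTime_le_of_isFutureCausalCurveOn hM hab.le hγ

/-- The set version: every point of `J⁺(S)` has static time at least the infimum over `S`; stated as
`∀ p ∈ J⁺(S), ∃ x ∈ S, t(x) ≤ t(p)`. -/
theorem exists_staticTime_le_of_mem_causalFuture [Kerr.Facts] (hM : 0 < M)
    {S : Set (Kerr.region 0 (Kerr.rPlus M 0))} {p : Kerr.region 0 (Kerr.rPlus M 0)}
    (hp : p ∈ (Kerr.smoothMetric M 0 (Kerr.rPlus M 0)).causalFuture (ksTime hM.le) S) :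
    ∃ x ∈ S, staticTime M x.1 ≤ staticTime M p.1 := by
  rcases hp with hp | ⟨x, hx, γ, a, b, hab, hγ, hγa, hγb⟩
  · exact ⟨p, hp, le_rfl⟩
  · refine ⟨x, hx, ?_⟩
    rw [← hγa, ← hγb]
    exact staticTime_le_of_isFutureCausalCurveOn hM hab.le hγ

end TimeFunction

/-! ## The static slice and its causal future -/

section Slice

variable {M : ℝ}

/-- Areal radius of the isotropic radius `ρ`: `r = ρ (1 + M/2ρ)²`, and `r/ρ = (1 + M/2ρ)²`. -/
theorem norm_isoScale_smul (y : E3) (M : ℝ) :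
    ‖(1 + M / (2 * ‖y‖)) ^ 2 • y‖ = ‖y‖ * (1 + M / (2 * ‖y‖)) ^ 2 := by
  rw [norm_smul, Real.norm_of_nonneg (sq_nonneg _), mul_comm]

/-- **The inverse isotropic radius.** For `r > 2M > 0` put `ρ = (r − M + √(r² − 2Mr))/2`; then
`ρ > M/2` and `ρ (1 + M/2ρ)² = r`. -/
theorem isoRadius_spec (hM : 0 < M) {r : ℝ} (hr : 2 * M < r) :
    M / 2 < (r - M + Real.sqrt (r ^ 2 - 2 * M * r)) / 2 ∧
      (r - M + Real.sqrt (r ^ 2 - 2 * M * r)) / 2 *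
          (1 + M / (2 * ((r - M + Real.sqrt (r ^ 2 - 2 * M * r)) / 2))) ^ 2 = r := by
  set D := Real.sqrt (r ^ 2 - 2 * M * r) with hD
  have hpos : 0 < r ^ 2 - 2 * M * r := by nlinarith
  have hD0 : 0 ≤ D := Real.sqrt_nonneg _
  have hD2 : D ^ 2 = r ^ 2 - 2 * M * r := Real.sq_sqrt hpos.le
  have hρ : M / 2 < (r - M + D) / 2 := by linarith
  refine ⟨hρ, ?_⟩
  have hA : 0 < r - M + D := by linarith
  -- `(2ρ + M)² = 4 r ρ`
  have key : (r + D) ^ 2 = 2 * r * (r - M + D) := by nlinarith [hD2]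
  have e1 : 1 + M / (2 * ((r - M + D) / 2)) = (r + D) / (r - M + D) := by
    field_simp
    ring
  rw [e1, div_pow, key]
  field_simp

/-- **The range of the static slice map is the static slice `{t = 0}`.** -/
theorem range_sheet_eq (hM : 0 < M) {ψ : Schwarzschild.isotropicExterior M → Kerr.region 0 (Kerr.rPlus M 0)}
    (hψ : ∀ y, (ψ y : E4) =
      E4.ofTimeSpace (2 * M * Real.log (‖(y : E3)‖ * (1 + M / (2 * ‖(y : E3)‖)) ^ 2 / (2 * M) - 1))
        ((1 + M / (2 * ‖(y : E3)‖)) ^ 2 • (y : E3))) :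
    Set.range ψ = {x | staticTime M x.1 = 0} := by
  ext x
  constructor
  · rintro ⟨y, rfl⟩
    show staticTime M (ψ y).1 = 0
    rw [staticTime_eq, hψ y, E4.spatialNorm_ofTimeSpace, norm_isoScale_smul]
    show 2 * M * Real.log (‖(y : E3)‖ * (1 + M / (2 * ‖(y : E3)‖)) ^ 2 / (2 * M) - 1) -
      torH M (‖(y : E3)‖ * (1 + M / (2 * ‖(y : E3)‖)) ^ 2) = 0
    rw [torH_eq, sub_self]
  · intro hx
    have hr : 2 * M < E4.spatialNorm x.1 := two_mul_lt_spatialNorm hM.le x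
    set r := E4.spatialNorm x.1 with hr_def
    obtain ⟨hρ, hρr⟩ := isoRadius_spec hM hr
    set ρ := (r - M + Real.sqrt (r ^ 2 - 2 * M * r)) / 2 with hρ_def
    have hρ0 : 0 < ρ := by linarith
    have hr0 : 0 < r := by linarith
    -- the isotropic point
    set y : E3 := (ρ / r) • E4.spatial x.1 with hy_def
    have hyn : ‖y‖ = ρ := by
      rw [hy_def, norm_smul, Real.norm_of_nonneg (by positivity)]
      show ρ / r * E4.spatialNorm x.1 = ρ
      rw [← hr_def]; field_simp
    have hymem : y ∈ Schwarzschild.isotropicExterior M := by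
      rw [Schwarzschild.mem_isotropicExterior, hyn]; exact hρ
    refine ⟨⟨y, hymem⟩, ?_⟩
    apply Subtype.ext
    rw [hψ]
    simp only []
    rw [hyn]
    have hscale : (1 + M / (2 * ρ)) ^ 2 • y = E4.spatial x.1 := by
      rw [hy_def, smul_smul]
      have : (1 + M / (2 * ρ)) ^ 2 * (ρ / r) = 1 := by
        rw [mul_div_assoc', show (1 + M / (2 * ρ)) ^ 2 * ρ = r by rw [mul_comm]; exact hρr,
          div_self hr0.ne']
      rw [this, one_smul]
    have htime : 2 * M * Real.log (ρ * (1 + M / (2 * ρ)) ^ 2 / (2 * M) - 1) = x.1 0 := by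
      rw [hρr]
      have h0 : staticTime M x.1 = 0 := hx
      rw [staticTime_eq, torH_eq, sub_eq_zero] at h0
      exact h0.symm
    rw [hscale, htime]
    exact E4.ofTimeSpace_time_spatial x.1

/-- A slice point below every event: `x − t(x) e₀ ∈ Σ₀`. -/
theorem vert_neg_staticTime_mem_range [Kerr.Facts] (hM : 0 < M)
    {ψ : Schwarzschild.isotropicExterior M → Kerr.region 0 (Kerr.rPlus M 0)}
    (hψ : ∀ y, (ψ y : E4) =
      E4.ofTimeSpace (2 * M * Real.log (‖(y : E3)‖ * (1 + M / (2 * ‖(y : E3)‖)) ^ 2 / (2 * M) - 1))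
        ((1 + M / (2 * ‖(y : E3)‖)) ^ 2 • (y : E3)))
    (x : Kerr.region 0 (Kerr.rPlus M 0)) :
    vert x (-staticTime M x.1) ∈ Set.range ψ := by
  rw [range_sheet_eq hM hψ]
  show staticTime M (vert x (-staticTime M x.1)).1 = 0
  rw [staticTime_vert]; ring

/-- **`J⁺(Σ₀) = {t ≥ 0}`** in the Schwarzschild exterior. -/
theorem causalFuture_range_sheet [Kerr.Facts] (hM : 0 < M)
    {ψ : Schwarzschild.isotropicExterior M → Kerr.region 0 (Kerr.rPlus M 0)}
    (hψ : ∀ y, (ψ y : E4) =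
      E4.ofTimeSpace (2 * M * Real.log (‖(y : E3)‖ * (1 + M / (2 * ‖(y : E3)‖)) ^ 2 / (2 * M) - 1))
        ((1 + M / (2 * ‖(y : E3)‖)) ^ 2 • (y : E3))) :
    (Kerr.smoothMetric M 0 (Kerr.rPlus M 0)).causalFuture (ksTime hM.le) (Set.range ψ) =
      {x | 0 ≤ staticTime M x.1} := by
  ext p
  constructor
  · intro hp
    obtain ⟨x, hx, hle⟩ := exists_staticTime_le_of_mem_causalFuture hM hp
    rw [range_sheet_eq hM hψ] at hx
    have hx0 : staticTime M x.1 = 0 := hx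
    show 0 ≤ staticTime M p.1
    linarith
  · intro hp
    have hp' : 0 ≤ staticTime M p.1 := hp
    have hmem := vert_neg_staticTime_mem_range hM hψ p
    have hJ := mem_causalFuture_vert hM (vert p (-staticTime M p.1)) hp'
    rw [vert_add, neg_add_cancel, vert_zero] at hJ
    exact LorentzianMetric.causalFuture_mono (singleton_subset_iff.2 hmem) hJ

end Slice

/-- **Anchor of part 4** (registered sub-goal of `stub_regionOneDecomposition`): `J⁺(Σ₀) = {t ≥ 0}` for the
static slice `Σ₀ = range ψ` of the Schwarzschild exterior. -/
theorem regionOneExterior_anchor : ∀ [Kerr.Facts] (M : ℝ) (hM : 0 < M) (ψ : Schwarzschild.isotropicExterior M → Kerr.region 0 (Kerr.rPlus M 0)), (∀ y, (ψ y : E4) = E4.ofTimeSpace (2 * M * Real.log (‖(y : E3)‖ * (1 + M / (2 * ‖(y : E3)‖)) ^ 2 / (2 * M) - 1)) ((1 + M / (2 * ‖(y : E3)‖)) ^ 2 • (y : E3))) → (Kerr.smoothMetric M 0 (Kerr.rPlus M 0)).causalFuture ((Kerr.timeOrientation M 0 (Kerr.rPlus M 0) hM.le).ofLE le_top) (Set.range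 ψ) = {x | 0 ≤ staticTime M x.1} := by
  intro _ M hM ψ hψ
  exact causalFuture_range_sheet hM hψ

end Summit.FinalStateConjecture.FinalStateConjecture.Theorems.SwallowTheDatum.UniversalWitnessFamily

end
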